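import Literature.Topology.FourManifolds.TautFoliationsEdgeChartGeneral
import HarnessLib

/-!
# Sides of the roof–floor edge chart, in motion-invariant terms

Topic: sequel to `TautFoliationsEdgeChartGeneral.lean`. For the edge chart in general position
(`EdgeDataAt … T`, `T` a motion with `T b = T a + (2ℓ, 0)`) we describe its source and its
height coordinate without reference to `T`:

* `edgeDiamond_subset_balls_edge` (**proved**): the standard diamond lies in
  `ball c ℓ ∪ ball c' ℓ ∪ {p | p.1 = c.1 + ℓ, |p.2 - c.2| < ℓ}`;
* `ConeSquare.openEdge a b ℓ` (**definition**): the points on both boundary squares within `ℓ`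
  of the midpoint of the centres — motion-invariant (`motion_mem_openEdge_iff`) and equal to the
  open common edge in standard position (`mem_openEdge_std_iff`);
* `EdgeDataAt.source_subset` (**proved**): the source lies in `ball a ℓ ∪ ball b ℓ ∪ openEdge a b ℓ`;
  `EdgeDataAt.openEdge_subset_source`;
* `EdgeDataAt.canonHt` (**definition**) `= if dist y a ≤ ℓ then coneHt a … y else σ (coneHt b … y)`
  and `EdgeDataAt.chart_snd_eq_canonHt` (**proved**): on the source the height coordinate is the
  canonical glued height (the side condition `(T y).1 ≤ (T a).1 + ℓ` is `dist y a ≤ ℓ` there);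
  `chart_snd_of_mem_ball_left/right`.

All statements are [folklore].
-/

noncomputable section

open Set Filter Metric Topology

namespace Literature.Topology.FourManifolds

namespace ConeSquare

variable {a b c : ℝ × ℝ} {ℓ m m' : ℝ} {ψ ψ' : ℝ × ℝ → ℝ} {σ : ℝ ≃o ℝ} {x y : ℝ × ℝ}

/-- **The standard diamond lies in the two open squares and the open edge.** [folklore] -/
theorem edgeDiamond_subset_balls_edge (hℓ : 0 < ℓ) :
    edgeDiamond c ℓ ⊆ ball c ℓ ∪ ball (rightCenter c ℓ) ℓ ∪ {p | p.1 = c.1 + ℓ ∧ |p.2 - c.2| < ℓ} := by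
  intro y hy
  rcases lt_trichotomy y.1 (c.1 + ℓ) with hlt | heq | hgt
  · obtain ⟨hdist, -, -, -, -, -⟩ := left_fan hℓ hy hlt.le
    left; left
    rw [mem_ball, hdist]; linarith
  · right
    have h0 : |y.2 - c.2| < min (y.1 - c.1) (c.1 + 2 * ℓ - y.1) := hy
    refine ⟨heq, ?_⟩
    have := lt_of_lt_of_le h0 (min_le_left _ _)
    rw [heq] at this; linarith [this]
  · obtain ⟨hdist, -, -, -, -, -⟩ := right_fan hℓ hy hgt.le
    left; right
    rw [mem_ball, hdist]; linarith

/-- **The open common edge of two squares, in motion-invariant terms**: on both boundaries and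
within `ℓ` of the midpoint of the centres. [folklore] -/
def openEdge (a b : ℝ × ℝ) (ℓ : ℝ) : Set (ℝ × ℝ) :=
  {y | y ∈ sphere a ℓ ∧ y ∈ sphere b ℓ ∧ dist y (a + (1 / 2 : ℝ) • (b - a)) < ℓ}

/-- In standard position (`b = a + (2ℓ, 0)`) the open edge is the open right edge of `a`.
[folklore] -/
theorem mem_openEdge_std_iff (hℓ : 0 < ℓ) :
    y ∈ openEdge c (rightCenter c ℓ) ℓ ↔ y.1 = c.1 + ℓ ∧ |y.2 - c.2| < ℓ := by
  have hmid : c + (1 / 2 : ℝ) • (rightCenter c ℓ - c) = (c.1 + ℓ, c.2) := by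
    rw [rightCenter]
    ext <;> simp only [Prod.smul_fst, Prod.smul_snd, Prod.fst_add, Prod.snd_add, Prod.fst_sub, Prod.snd_sub, smul_eq_mul] <;> ring
  constructor
  · rintro ⟨h1, h2, h3⟩
    rw [mem_sphere, Prod.dist_eq, Real.dist_eq, Real.dist_eq] at h1 h2
    rw [rightCenter] at h2
    simp only at h2
    have e1 := le_max_left |y.1 - c.1| |y.2 - c.2|
    rw [h1] at e1
    have e2 := le_max_left |y.1 - (c.1 + 2 * ℓ)| |y.2 - c.2|
    rw [h2] at e2
    rw [abs_le] at e1 e2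
    have hy1 : y.1 = c.1 + ℓ := by linarith
    refine ⟨hy1, ?_⟩
    rw [hmid, Prod.dist_eq, Real.dist_eq, Real.dist_eq, hy1] at h3
    simp only [sub_self, abs_zero] at h3
    exact lt_of_le_of_lt (le_max_right _ _) h3
  · rintro ⟨h1, h2⟩
    refine ⟨?_, ?_, ?_⟩
    · rw [mem_sphere, Prod.dist_eq, Real.dist_eq, Real.dist_eq, h1, show c.1 + ℓ - c.1 = ℓ by ring, abs_of_pos hℓ]
      exact max_eq_left h2.le
    · rw [mem_sphere, Prod.dist_eq, Real.dist_eq, Real.dist_eq, h1, rightCenter]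
      simp only
      rw [show c.1 + ℓ - (c.1 + 2 * ℓ) = -ℓ by ring, abs_neg, abs_of_pos hℓ]
      exact max_eq_left h2.le
    · rw [hmid, Prod.dist_eq, Real.dist_eq, Real.dist_eq, h1]
      simp only [sub_self, abs_zero]
      exact max_lt hℓ h2

/-- **Motions preserve the open edge.** [folklore] -/
theorem motion_mem_openEdge_iff {T : (ℝ × ℝ) ≃ₜ (ℝ × ℝ)} (hT : IsPlaneMotion T) :
    T y ∈ openEdge (T a) (T b) ℓ ↔ y ∈ openEdge a b ℓ := by
  show (T y ∈ sphere (T a) ℓ ∧ T y ∈ sphere (T b) ℓ ∧ dist (T y) (T a + (1 / 2 : ℝ) • (T b - T a)) < ℓ) ↔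
    (y ∈ sphere a ℓ ∧ y ∈ sphere b ℓ ∧ dist y (a + (1 / 2 : ℝ) • (b - a)) < ℓ)
  rw [hT.mem_sphere_iff, hT.mem_sphere_iff, ← hT.affine a b (1 / 2), hT.dist_eq]

namespace EdgeDataAt

variable {T : (ℝ × ℝ) ≃ₜ (ℝ × ℝ)} (E : EdgeDataAt a b ℓ m m' ψ ψ' σ T)
include E

/-- **The source of the edge chart lies in the two open squares and the open edge.** [folklore] -/
theorem source_subset : E.chart.source ⊆ ball a ℓ ∪ ball b ℓ ∪ openEdge a b ℓ := by
  intro y hy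
  rw [E.chart_source, mem_preimage] at hy
  rcases edgeDiamond_subset_balls_edge E.hℓ hy with (h | h) | h
  · left; left
    rw [mem_ball, ← E.motion.dist_eq]; exact h
  · left; right
    rw [mem_ball, ← E.motion.dist_eq, E.map_right]; exact h
  · right
    rw [← motion_mem_openEdge_iff E.motion, E.map_right, mem_openEdge_std_iff E.hℓ]
    exact h

/-- **The open edge lies in the source.** [folklore] -/
theorem openEdge_subset_source : openEdge a b ℓ ⊆ E.chart.source := by
  intro y hy
  rw [E.chart_source, mem_preimage]
  have h := (motion_mem_openEdge_iff E.motion (a := a) (b := b) (ℓ := ℓ) (y := y)).2 hy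
  rw [E.map_right, mem_openEdge_std_iff E.hℓ] at h
  have : T y = edgePt (T a) ℓ (T y).2 := by rw [edgePt, ← h.1]
  rw [this]
  exact E.edgeData.edgePt_mem_edgeDiamond (by rw [abs_lt] at h; exact ⟨by linarith [h.2.1], by linarith [h.2.2]⟩)

/-- On the source, the side condition of the chart is `dist y a ≤ ℓ`. [folklore] -/
theorem side_iff (hy : y ∈ E.chart.source) : (T y).1 ≤ (T a).1 + ℓ ↔ dist y a ≤ ℓ := by
  rw [E.chart_source, mem_preimage] at hy
  rw [← E.motion.dist_eq y a]
  constructor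
  · intro h
    obtain ⟨hdist, -, hQ, -⟩ := left_fan E.hℓ hy h
    exact mem_closedBall.1 hQ
  · intro h
    by_contra hgt
    push Not at hgt
    obtain ⟨hdist, hpos, -⟩ := right_fan E.hℓ hy hgt.le
    -- on the right fan, `dist (T y) (T a) ≥ (T y).1 - (T a).1 > ℓ`
    have : (T y).1 - (T a).1 ≤ dist (T y) (T a) := by
      rw [Prod.dist_eq, Real.dist_eq]
      exact (le_abs_self _).trans (le_max_left _ _)
    linarith

/-- **The canonical glued height** of the pair (roof `a`, floor `b`). [folklore] -/
def canonHt (_E : EdgeDataAt a b ℓ m m' ψ ψ' σ T) (y : ℝ × ℝ) : ℝ :=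
  if dist y a ≤ ℓ then coneHt a ℓ m ψ y else σ (coneHt b ℓ m' ψ' y)

/-- **On the source, the height coordinate of the edge chart is the canonical glued height**
(independent of the motion `T`). [folklore] -/
theorem chart_snd_eq_canonHt (hy : y ∈ E.chart.source) : (E.chart y).2 = E.canonHt y := by
  rw [E.chart_snd, canonHt]
  by_cases h : dist y a ≤ ℓ
  · rw [if_pos ((E.side_iff hy).2 h), if_pos h]
  · rw [if_neg (fun h' ↦ h ((E.side_iff hy).1 h')), if_neg h]

/-- On the open square of `a` the height is the cone height of `a`. [folklore] -/
theorem chart_snd_of_mem_ball_left (hy : y ∈ ball a ℓ) : (E.chart y).2 = coneHt a ℓ m ψ y := by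
  rw [E.chart_snd, if_pos]
  have : T y ∈ ball (T a) ℓ := by rw [mem_ball, E.motion.dist_eq]; exact hy
  rw [mem_ball, Prod.dist_eq, Real.dist_eq] at this
  have := lt_of_le_of_lt (le_max_left _ _) this
  rw [abs_lt] at this; linarith [this.2]

/-- On the open square of `b` the height is the converted cone height of `b`. [folklore] -/
theorem chart_snd_of_mem_ball_right (hy : y ∈ ball b ℓ) : (E.chart y).2 = σ (coneHt b ℓ m' ψ' y) := by
  rw [E.chart_snd, if_neg]
  have : T y ∈ ball (T b) ℓ := by rw [mem_ball, E.motion.dist_eq]; exact hy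
  rw [E.map_right, mem_ball, Prod.dist_eq, Real.dist_eq, rightCenter] at this
  have := lt_of_le_of_lt (le_max_left _ _) this
  simp only at this
  rw [abs_lt] at this
  push Not; linarith [this.1]

end EdgeDataAt

end ConeSquare

end Literature.Topology.FourManifolds
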